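import Literature.Probability.RandomPlanarGeometry.HullApproximationProofs
import Literature.Probability.RandomPlanarGeometry.RestrictionHullsRiemannProofs
import Literature.Probability.RandomPlanarGeometry.LoewnerSemigroup
import HarnessLib

/-!
# The chordal Loewner equation for a smooth hull, in the normalized form of [LSW] Lemma 3.5

G. F. Lawler, O. Schramm, W. Werner, *Conformal restriction: the chordal case*, J. Amer. Math.
Soc. **16** (2003) 917–955, arXiv:math/0209343 (**[LSW]**, arXiv page numbers), proof of
Lemma 3.5, p. 13, verbatim: "Note that [∂]`E_δ ∩ ℍ̄` is a simple path, say `β : [0, s] → ℍ̄`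
with `β(0), β(s) ∈ ℝ`. We may assume that `β` is parametrized by half-plane capacity from `∞`,
so that `a(β[0, t]) = 2t`, `t ∈ [0, s]`. Set `g_t := g_{β[0,t]}`, `Φ_t := Φ_{β[0,t]} = g_t - g_t(0)`,
`U_t := g_t(β(t))`, `Ũ_t := U_t - g_t(0) = Φ_t(β(t))`, `t ∈ [0, s]`. By the chordal version of
Loewner's theorem, we have `∂_t g_t(z) = 2/(g_t(z) - U_t)`. Thus,
`∂_t Φ_t(z) = 2/(Φ_t(z) - Ũ_t) + 2/Ũ_t = 2Φ_t(z)/((Φ_t(z) - Ũ_t) Ũ_t)`, `Φ_0(z) = z`. Since `Ũ_t`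
is continuous and positive, …" and later "`Φ^{(n)}_s(z) → Φ_s(z) = Φ_{E_δ}`".

"The chordal version of Loewner's theorem" invoked here is the slit theorem of
G. F. Lawler, *Conformally Invariant Processes in the Plane* (2005), §4.1: Lemma 4.2 (for a
simple curve `γ` from a real point into `ℍ`, `U_t = g_t(γ(t)) = lim_{z → γ(t)} g_t(z)` exists
and `t ↦ U_t` is continuous), Prop. 4.4 (`g_t(z)` solves `ġ_t(z) = ḃ(t)/(g_t(z) - U_t)`,
`b(t) = hcap γ(0, t]`, for `z` off the curve) and Remark 4.5 (reparametrization by half-plane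
capacity, `b(t) = 2t`), with (3.9) (`hcap(A) ≤ rad(A)²`) bounding the total time. None of this
(half-plane capacity, the expansion of `g_A` at `∞`, the estimates (3.12), (3.21) behind
Lemma 4.1) is in the tree, whose Loewner theory (`LoewnerChain`, `LoewnerFlow`, …) is the
FORWARD direction (hulls from a continuous driving function). We therefore vendor the statement
used on p. 13 as one named fact, for the smooth hulls to which [LSW] apply it — the tree's
`IsArcHull` (`HullApproximation`: `ℍ ∩ ∂J` is an open Jordan arc with two real endpoints, `J` a
bounded hull, i.e. the closed region under the arc) in `𝒬₊`:

* `Literature.Probability.RandomPlanarGeometry.IsArcHull.exists_normalizedLoewnerFlow` — NAMED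
  FACT: for such `J ⊆ B̄(0, R)` there are a time `0 < s ≤ R²/2`, a continuous positive
  `Ũ : [0, s] → (0, ∞)`, increasing hulls `K_t ∈ 𝒬₊` (`K_0 = ∅`, `K_s = J`, `K_t ⊆ J`: the arcs
  `β[0, t]`) with restriction maps `Φ_t` (`Φ_t = Φ_{β[0,t]}`, normalized at `0` and `∞` as all
  restriction maps of the tree), jointly continuous in `(t, z)`, solving
  `∂_t Φ_t(z) = 2Φ_t(z)/((Φ_t(z) - Ũ_t) Ũ_t)` on `[0, s]` for every `z ∈ ℍ ∖ J`, and with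
  `Ũ_t ∈ cl Φ_t((J ∖ K_t) ∩ ℍ)` for `t < s` (`Ũ_t = Φ_t(β(t))`, the image of the tip, Lemma 4.2).

The transcription choices (all forced by the tree's vocabulary): hulls are closed sets of the
tree's `IsPlusHull`; the maps are `IsRestrictionMap`s (so `Φ_0 = id` and `Φ_s = Φ_J` on `ℍ ∖ J`
by uniqueness, `IsStarHull.existsUnique_isRestrictionMap_holds`); the time derivative is a
`HasDerivWithinAt` on `[0, s]` (one-sided at the endpoints); "parametrized by half-plane
capacity" survives only as the constant `2` in the equation and the bound `s ≤ R²/2`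
(= `hcap(J)/2 ≤ rad(J)²/2`, Lawler (3.9)). Consumers: the density clause of Lemma 3.5
(`IsPlusHull.exists_isLSWGenerated_lswConverges`, `RestrictionDensity`), via the forward
stability of this equation under piecewise-constant approximation of `Ũ`.

Proved here: non-vacuity of the hypothesis (smooth `+`-hulls exist: the hulls `J_n ⊇ K_1` of
Lemma 2.1 around the Loewner hull `K_1`), and the two normalizations `Φ_0 = id`, `Φ_s = Φ_J`
that consumers need (`…flow_zero_apply`, `…flow_end_apply`).

## References

* [LSW] proof of Lemma 3.5, p. 13 [LawlerSchrammWerner2003Restriction].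
* G. F. Lawler (2005), §4.1: Lemma 4.2, Prop. 4.4, Remark 4.5; §3.4 (3.9) [Lawler2005].
-/

noncomputable section

open Set Filter Metric Function
open _root_.Topology
open UpperHalfPlane (upperHalfPlaneSet isOpen_upperHalfPlaneSet)
open scoped NNReal

namespace Literature.Probability.RandomPlanarGeometry

/-- NAMED FACT — **the chordal Loewner equation for the boundary arc of a smooth `+`-hull, in
the normalized form of [LSW]** (proof of Lemma 3.5, p. 13: "`β : [0, s] → ℍ̄` … parametrized by
half-plane capacity … `Φ_t := Φ_{β[0,t]}` … `Ũ_t := Φ_t(β(t))` … By the chordal version of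
Loewner's theorem … `∂_t Φ_t(z) = 2Φ_t(z)/((Φ_t(z) - Ũ_t) Ũ_t)`, `Φ_0(z) = z` … `Ũ_t` is
continuous and positive … `Φ_s = Φ_{E_δ}`"; the theorem invoked is Lawler (2005) Lemma 4.2,
Prop. 4.4, Remark 4.5, and `s = hcap(J)/2 ≤ rad(J)²/2` is (3.9) there). For a smooth hull
`J ∈ 𝒬₊` (`IsArcHull J`, `IsPlusHull J`) with `J ⊆ B̄(0, R)`: there exist `s ∈ (0, R²/2]`, a
function `Ũ` continuous and positive on `[0, s]`, hulls `K_t` and maps `Φ_t`, `t ∈ [0, s]`, such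
that each `K_t ∈ 𝒬₊` with `K_t ⊆ J`, `K_0 = ∅`, `K_s = J`, `t ↦ K_t` increasing, `Φ_t` a
restriction map of `K_t`, `(t, z) ↦ Φ_t(z)` continuous on `[0, s] × (ℍ ∖ J)`,
`Ũ_t ∈ cl Φ_t((J ∖ K_t) ∩ ℍ)` for `t ∈ [0, s)`, and for every `z ∈ ℍ ∖ J` the function
`t ↦ Φ_t(z)` solves `∂_t Φ_t(z) = 2Φ_t(z)/((Φ_t(z) - Ũ_t) Ũ_t)` on `[0, s]`.
[cite: LawlerSchrammWerner2003Restriction, proof of Lemma 3.5 (p. 13), the Loewner equation for Φ_t] [cite: Lawler2005, §4.1 Lemma 4.2, Prop. 4.4, Remark 4.5; §3.4 (3.9)] -/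
def IsArcHull.exists_normalizedLoewnerFlow : Prop :=
  ∀ {J : Set ℂ}, IsArcHull J → IsPlusHull J → ∀ {R : ℝ}, (∀ z ∈ J, ‖z‖ ≤ R) →
    ∃ (s : ℝ) (U : ℝ → ℝ) (K : ℝ → Set ℂ)
      (Φ : ∀ t : ℝ, ConformalEquiv (upperHalfPlaneSet \ K t) upperHalfPlaneSet),
      0 < s ∧ s ≤ R ^ 2 / 2 ∧ ContinuousOn U (Icc 0 s) ∧ (∀ t ∈ Icc 0 s, 0 < U t) ∧
      (∀ t ∈ Icc 0 s, IsPlusHull (K t) ∧ K t ⊆ J ∧ IsRestrictionMap (K t) (Φ t)) ∧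
      K 0 = ∅ ∧ K s = J ∧ MonotoneOn K (Icc 0 s) ∧
      (∀ t ∈ Ico 0 s, ((U t : ℝ) : ℂ) ∈ closure (Φ t '' ((J \ K t) ∩ upperHalfPlaneSet))) ∧
      ContinuousOn (fun p : ℝ × ℂ ↦ Φ p.1 p.2) (Icc 0 s ×ˢ (upperHalfPlaneSet \ J)) ∧
      ∀ z ∈ upperHalfPlaneSet \ J, ∀ t ∈ Icc 0 s,
        HasDerivWithinAt (fun τ ↦ Φ τ z) (2 * Φ t z / ((Φ t z - U t) * U t)) (Icc 0 s) t

/-! ### Non-vacuity of the hypothesis and the normalizations at `t = 0`, `t = s` -/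

/-- **Smooth `+`-hulls exist** (non-vacuity of the hypothesis of the fact): e.g. the smooth
hulls of [LSW] Lemma 2.1 around the nonempty `+`-hull `K_1` (`IsPlusHull.arcHull`,
`HullApproximationProofs`). [folklore] -/
example : ∃ J : Set ℂ, IsArcHull J ∧ IsPlusHull J := by
  have hne : (lswHull 1).Nonempty :=
    (lswHull_inter_nonempty one_pos).mono inter_subset_left
  obtain ⟨J, hJa, hJp, -⟩ := IsPlusHull.exists_antitone_isArcHull_holds (isPlusHull_lswHull 1) hne
  exact ⟨J 0, hJa 0, hJp 0⟩

section Consequences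

variable {J : Set ℂ} {s : ℝ} {K : ℝ → Set ℂ}
  {Φ : ∀ t : ℝ, ConformalEquiv (upperHalfPlaneSet \ K t) upperHalfPlaneSet}

/-- **`Φ_0 = id` on `ℍ`**: a restriction map of `K_0 = ∅` is the identity on the half-plane
(uniqueness of restriction maps). [folklore] -/
theorem normalizedLoewnerFlow_zero_apply (hK0 : K 0 = ∅) (hΦ0 : IsRestrictionMap (K 0) (Φ 0))
    {z : ℂ} (hz : z ∈ upperHalfPlaneSet) : Φ 0 z = z := by
  have hst : IsStarHull (K 0) := by rw [hK0]; exact isStarHull_empty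
  obtain ⟨Φ₀, -, hU⟩ := IsStarHull.existsUnique_isRestrictionMap_holds hst
  have hz' : z ∈ upperHalfPlaneSet \ K 0 := by rw [hK0]; simpa using hz
  have hid : IsRestrictionMap (K 0) (restrictionMapEmpty.copy _ _ (by rw [hK0]) rfl) :=
    isRestrictionMap_empty.of_eq hK0.symm
  rw [hU _ hΦ0 hz', ← hU _ hid hz', ConformalEquiv.copy_apply, restrictionMapEmpty_apply]

/-- **`Φ_s = Φ_J` on `ℍ ∖ J`**: the final map is any prescribed restriction map of `J = K_s`
(uniqueness of restriction maps). [folklore] -/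
theorem normalizedLoewnerFlow_end_apply (hJ : IsStarHull J) (hKs : K s = J)
    (hΦs : IsRestrictionMap (K s) (Φ s)) {ΦJ : ConformalEquiv (upperHalfPlaneSet \ J) upperHalfPlaneSet}
    (hΦJ : IsRestrictionMap J ΦJ) {z : ℂ} (hz : z ∈ upperHalfPlaneSet \ J) : Φ s z = ΦJ z := by
  subst hKs
  obtain ⟨Φ₀, -, hU⟩ := IsStarHull.existsUnique_isRestrictionMap_holds hJ
  rw [hU _ hΦs hz, hU _ hΦJ hz]

end Consequences

end Literature.Probability.RandomPlanarGeometry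

end
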